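import Summits.HubbardSuperconductivity.HubbardSuperconductivity.Theorems.AnisotropyChordInsertionEntropyStructureFactor
import Summits.HubbardSuperconductivity.HubbardSuperconductivity.Theorems.AnisotropyChordInsertionEntropyLatticeSum
import Summits.HubbardSuperconductivity.HubbardSuperconductivity.Theorems.AnisotropyChordInsertionEntropyLinks

/-!
# Route `AnisotropyChord` / H0 rotor rung: the entropy route — THE REDUCTION `H1 ∧ (IR_α) ∧ (S ≤ S_max) ⇒ E_J`
# PROVED on the density window (theory seat memo ROTOR-THEORY-7 §93, typed as `EntropyRouteReduction`
# with «Lean proof deferred»), and the kernel-checked chain `H1 ∧ (IR_α) ∧ (S ≤ S_max) ⇒ BEC`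

Paper proof (memo §93): `J_x = Σ_s U δρ_x + (E_ν − E_π̃)R` (`jDiv_holeLaw_eq_onebody`); Parseval and
`δρ̂_x(k) = φ_k(x)[S_N − 1 + ρ_M S_M/(1 − ρ_M)]` (`k ≠ 0`), `δρ̂_x(0) = 0`
(`AnisotropyChordInsertionEntropyStructureFactor`) give
`|Σ_s U δρ_x| ≤ L⁻² Σ_{k≠0} |Û(k)| B ≤ (C₁ B/(c P_M)) Σ_{k≠0} |k|_T^{−α}` with `B = S_max + 1 + ρ_M S_max/(1−ρ_M)`,
and the lattice sum `Σ_{k≠0} |k|_T^{−α} ≤ C(α) L²` (`α < 2`, `d = 2`; `AnisotropyChordInsertionEntropyLatticeSum`)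
makes this `≤ C₁ B C(α)/(c ρ_M)`, uniformly in `L`.

* `sum_mul_insertionResponse_le` — the finite-volume Fourier bound on the one-body part of `J_x`;
* `jDiv_le_of_onebody_data` — the finite-volume bound on `J_x` from the H1 data;
* **`insertionJBound_of_onebody_infrared`** — `H1 ∧ (IR_α) ∧ (S ≤ S_max) ⇒ E_J` along every sector
  sequence of density `ρ_L → ρ ∈ (0,1)` (this is the content of `EntropyRouteReduction`; the typed
  `∀ M` form quantifies also over degenerate sequences `ρ_M → 0, 1`, where the paper constant
  `~ 1/(ρ_M(1 − ρ_M))` is not uniform — recorded for the theory seat, not claimed);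
* **`insertionEntropyBound_of_onebody_infrared`**, **`eventualCondensate_of_onebody_infrared`** — the
  composed chain `H1 ∧ (IR_α) ∧ (S ≤ S_max) ⇒ E ⇒ BEC` with every support statement discharged
  (`uniformSiteDensity_holds`, `perronSectorExists_of_ne_bot`): the entropy route's architecture v2
  (memo §93/§100) is kernel-checked end to end; the open physics is exactly `H1` (`OneBodyInsertionStructure`)
  and `(IR_α)` (`InfraredStructureBound`, ⟸ LEMMA M + (Λ_α) + (K₂)).
-/

set_option linter.dupNamespace false

noncomputable section

open Matrix Finset Filter Topology Complex
open scoped ComplexConjugate Real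
open Literature.MathematicalPhysics.QuantumLattice Literature.Probability.LatticeModels

namespace Summit.HubbardSuperconductivity.HubbardSuperconductivity.Theorems.AnisotropyChord.InsertionEntropy

/-! ## The finite-volume bound -/

section Finite

variable {L : ℕ} [NeZero L]

/-- **Finite-volume Fourier bound on the one-body part of `J_x`:** if `δρ̂_x(0) = 0`, `|δρ̂_x(k)| ≤ B`,
`|Û(k)| S_M(k) P_M ≤ C₁ L²` and `S_M(k) ≥ c|k|_T^α` for `k ≠ 0`, then
`Σ_s U(s) δρ_x(s) ≤ (C₁ B/(c P_M)) · Σ_{k≠0} |k|_T^{−α}`. [folklore] -/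
theorem sum_mul_insertionResponse_le (aM aN : TensorIndex (TorusSite 2 L) 2 → ℝ) (x : TorusSite 2 L)
    (U : TorusSite 2 L → ℝ) (PM C₁ c α B : ℝ) (hC₁ : 0 ≤ C₁) (hc : 0 < c) (hPM : 0 < PM)
    (h0 : kernelFT L (insertionResponse aM aN x) 0 = 0)
    (hresp : ∀ k : TorusSite 2 L, k ≠ 0 → ‖kernelFT L (insertionResponse aM aN x) k‖ ≤ B)
    (hU : ∀ k : TorusSite 2 L, k ≠ 0 →
      ‖kernelFT L U k‖ * structureFactor L aM PM k * PM ≤ C₁ * (L : ℝ) ^ 2)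
    (hIR : ∀ k : TorusSite 2 L, k ≠ 0 → c * (torusNorm L k) ^ α ≤ structureFactor L aM PM k) :
    ∑ s, U s * insertionResponse aM aN x s
      ≤ C₁ * B / (c * PM) * ∑ k ∈ Finset.univ.filter (fun k : TorusSite 2 L => k ≠ 0), (torusNorm L k) ^ (-α) := by
  have hL : (0 : ℝ) < (L : ℝ) ^ 2 := by
    have : (0 : ℝ) < (L : ℝ) := by exact_mod_cast Nat.pos_of_ne_zero (NeZero.ne L)
    positivity
  have hL' : (L : ℝ) ≠ 0 := by exact_mod_cast (NeZero.ne L)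
  have hpar := abs_sum_mul_le_sum_norm_kernelFT U (insertionResponse aM aN x)
  -- pointwise bound in Fourier space
  have hpt : ∀ k : TorusSite 2 L, k ≠ 0 →
      ‖kernelFT L U k‖ * ‖kernelFT L (insertionResponse aM aN x) k‖
        ≤ C₁ * (L : ℝ) ^ 2 * B / (c * PM) * (torusNorm L k) ^ (-α) := by
    intro k hk
    have hnorm := torusNorm_pos hk
    have hkα : 0 < (torusNorm L k) ^ α := Real.rpow_pos_of_pos hnorm α
    have hS : 0 < structureFactor L aM PM k := lt_of_lt_of_le (by positivity) (hIR k hk)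
    have hUk : ‖kernelFT L U k‖ ≤ C₁ * (L : ℝ) ^ 2 / (structureFactor L aM PM k * PM) := by
      rw [le_div_iff₀ (by positivity), ← mul_assoc]; exact hU k hk
    have hUk' : ‖kernelFT L U k‖ ≤ C₁ * (L : ℝ) ^ 2 / (c * (torusNorm L k) ^ α * PM) := by
      refine hUk.trans ?_
      exact div_le_div_of_nonneg_left (by positivity) (by positivity)
        (mul_le_mul_of_nonneg_right (hIR k hk) hPM.le)
    calc ‖kernelFT L U k‖ * ‖kernelFT L (insertionResponse aM aN x) k‖
        ≤ C₁ * (L : ℝ) ^ 2 / (c * (torusNorm L k) ^ α * PM) * B :=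
          mul_le_mul hUk' (hresp k hk) (norm_nonneg _) (by positivity)
      _ = C₁ * (L : ℝ) ^ 2 * B / (c * PM) * (torusNorm L k) ^ (-α) := by
          rw [Real.rpow_neg hnorm.le]
          field_simp
  -- drop the `k = 0` term and sum
  have hsum : ∑ k, ‖kernelFT L U k‖ * ‖kernelFT L (insertionResponse aM aN x) k‖
      = ∑ k ∈ Finset.univ.filter (fun k : TorusSite 2 L => k ≠ 0),
          ‖kernelFT L U k‖ * ‖kernelFT L (insertionResponse aM aN x) k‖ := by
    rw [Finset.sum_filter_of_ne]
    intro k _ hne hk0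
    apply hne
    rw [hk0, h0, norm_zero, mul_zero]
  have hbound : ∑ k, ‖kernelFT L U k‖ * ‖kernelFT L (insertionResponse aM aN x) k‖
      ≤ C₁ * (L : ℝ) ^ 2 * B / (c * PM) *
          ∑ k ∈ Finset.univ.filter (fun k : TorusSite 2 L => k ≠ 0), (torusNorm L k) ^ (-α) := by
    rw [hsum, Finset.mul_sum]
    refine Finset.sum_le_sum fun k hk => ?_
    rw [Finset.mem_filter] at hk
    exact hpt k hk.2
  calc ∑ s, U s * insertionResponse aM aN x s ≤ |∑ s, U s * insertionResponse aM aN x s| := le_abs_self _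
    _ ≤ (∑ k, ‖kernelFT L U k‖ * ‖kernelFT L (insertionResponse aM aN x) k‖) / (L : ℝ) ^ 2 := hpar
    _ ≤ (C₁ * (L : ℝ) ^ 2 * B / (c * PM) *
          ∑ k ∈ Finset.univ.filter (fun k : TorusSite 2 L => k ≠ 0), (torusNorm L k) ^ (-α)) / (L : ℝ) ^ 2 :=
        div_le_div_of_nonneg_right hbound hL.le
    _ = C₁ * B / (c * PM) * ∑ k ∈ Finset.univ.filter (fun k : TorusSite 2 L => k ≠ 0), (torusNorm L k) ^ (-α) := by
        field_simp

/-- **Finite-volume bound on `J_x` from the H1 data** (Perron amplitudes of adjacent sectors with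
densities in `(0,1)`): `J_x ≤ r + (C₁ B/(c P_M)) Σ_{k≠0} |k|_T^{−α}`,
`B = S_max + 1 + S_max/(1 − ρ')` for any `S_max ≥ 0` dominating both structure factors and `ρ' ≥ ρ_M`,
`ρ' < 1`. [folklore] -/
theorem jDiv_le_of_onebody_data (Δ M : ℝ) (aM aN : TensorIndex (TorusSite 2 L) 2 → ℝ)
    (haN : IsPerronSectorGroundAmplitude L Δ M aN) (haM : IsPerronSectorGroundAmplitude L Δ (M - 1) aM)
    (hρN : 0 < 1 / 2 + M / (L : ℝ) ^ 2) (hρM0 : 0 < 1 / 2 + (M - 1) / (L : ℝ) ^ 2)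
    (ρ' : ℝ) (hρ' : ρ' < 1) (hρMle : 1 / 2 + (M - 1) / (L : ℝ) ^ 2 ≤ ρ')
    (x : TorusSite 2 L) (U : TorusSite 2 L → ℝ) (cst : ℝ) (R : TensorIndex (TorusSite 2 L) 2 → ℝ)
    (r C₁ c α Smax : ℝ) (hC₁ : 0 ≤ C₁) (hc : 0 < c) (hSmax : 0 ≤ Smax)
    (hac : ∀ τ, 0 < holeLaw aN x τ ↔ 0 < vacantLaw aM x τ)
    (hF : ∀ τ, 0 < vacantLaw aM x τ →
      Real.log (holeLaw aN x τ / vacantLaw aM x τ) = cst + linStat U τ + R τ)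
    (hrem : ∑ τ, (holeLaw aN x τ - vacantLaw aM x τ) * R τ ≤ r)
    (hU : ∀ k : TorusSite 2 L, k ≠ 0 →
      ‖kernelFT L U k‖ * structureFactor L aM ((L : ℝ) ^ 2 / 2 + (M - 1)) k
          * ((L : ℝ) ^ 2 / 2 + (M - 1)) ≤ C₁ * (L : ℝ) ^ 2)
    (hIR : ∀ k : TorusSite 2 L, k ≠ 0 →
      c * (torusNorm L k) ^ α ≤ structureFactor L aM ((L : ℝ) ^ 2 / 2 + (M - 1)) k)
    (hSN : ∀ k : TorusSite 2 L, k ≠ 0 → structureFactor L aN ((L : ℝ) ^ 2 / 2 + M) k ≤ Smax)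
    (hSM : ∀ k : TorusSite 2 L, k ≠ 0 → structureFactor L aM ((L : ℝ) ^ 2 / 2 + (M - 1)) k ≤ Smax) :
    jDiv (holeLaw aN x) (vacantLaw aM x)
      ≤ r + C₁ * (Smax + 1 + Smax / (1 - ρ')) / (c * ((L : ℝ) ^ 2 / 2 + (M - 1)))
          * ∑ k ∈ Finset.univ.filter (fun k : TorusSite 2 L => k ≠ 0), (torusNorm L k) ^ (-α) := by
  have hL : (0 : ℝ) < (L : ℝ) ^ 2 := by
    have : (0 : ℝ) < (L : ℝ) := by exact_mod_cast Nat.pos_of_ne_zero (NeZero.ne L)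
    positivity
  have hL' : (L : ℝ) ≠ 0 := by exact_mod_cast (NeZero.ne L)
  -- densities and particle numbers
  have hdN : ∀ s, siteDensity aN s = 1 / 2 + M / (L : ℝ) ^ 2 :=
    fun s => siteDensity_eq_of_isPerron L Δ M aN haN s
  have hdM : ∀ s, siteDensity aM s = 1 / 2 + (M - 1) / (L : ℝ) ^ 2 :=
    fun s => siteDensity_eq_of_isPerron L Δ (M - 1) aM haM s
  have hρM1 : 1 / 2 + (M - 1) / (L : ℝ) ^ 2 < 1 := lt_of_le_of_lt hρMle hρ'
  have hPN : (L : ℝ) ^ 2 / 2 + M = (L : ℝ) ^ 2 * (1 / 2 + M / (L : ℝ) ^ 2) := by field_simp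
  have hPM : (L : ℝ) ^ 2 / 2 + (M - 1) = (L : ℝ) ^ 2 * (1 / 2 + (M - 1) / (L : ℝ) ^ 2) := by field_simp
  have hPM0 : 0 < (L : ℝ) ^ 2 / 2 + (M - 1) := by rw [hPM]; positivity
  -- J = one-body part + remainder
  rw [jDiv_holeLaw_eq_onebody aM aN x U R cst (by rw [hdN x]; exact hρN) haM.unit
    (by rw [hdM x]; exact hρM1) hac hF]
  -- the response bound `B`
  set B : ℝ := Smax + 1 + Smax / (1 - ρ') with hBdef
  have h1ρ' : 0 < 1 - ρ' := sub_pos.mpr hρ'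
  have hbN := perronAmplitude_shiftConfig Δ M aN haN
  have hbM := perronAmplitude_shiftConfig Δ (M - 1) aM haM
  have hresp : ∀ k : TorusSite 2 L, k ≠ 0 → ‖kernelFT L (insertionResponse aM aN x) k‖ ≤ B := by
    intro k hk
    have h := norm_kernelFT_insertionResponse_le aM aN (1 / 2 + M / (L : ℝ) ^ 2)
      (1 / 2 + (M - 1) / (L : ℝ) ^ 2) ((L : ℝ) ^ 2 / 2 + M) ((L : ℝ) ^ 2 / 2 + (M - 1)) hbN hbM hdN hdM
      hρN hρM0.le hρM1 hPN hPM hPM0 x k hk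
    refine h.trans ?_
    rw [hBdef]
    have h1 : structureFactor L aN ((L : ℝ) ^ 2 / 2 + M) k ≤ Smax := hSN k hk
    have h2 : (1 / 2 + (M - 1) / (L : ℝ) ^ 2) * structureFactor L aM ((L : ℝ) ^ 2 / 2 + (M - 1)) k
        / (1 - (1 / 2 + (M - 1) / (L : ℝ) ^ 2)) ≤ Smax / (1 - ρ') := by
      have hSMk := hSM k hk
      have hS0 : 0 ≤ structureFactor L aM ((L : ℝ) ^ 2 / 2 + (M - 1)) k :=
        structureFactor_nonneg aM hPM0.le k
      have h1m : 0 < 1 - (1 / 2 + (M - 1) / (L : ℝ) ^ 2) := sub_pos.mpr hρM1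
      calc (1 / 2 + (M - 1) / (L : ℝ) ^ 2) * structureFactor L aM ((L : ℝ) ^ 2 / 2 + (M - 1)) k
            / (1 - (1 / 2 + (M - 1) / (L : ℝ) ^ 2))
          ≤ 1 * Smax / (1 - (1 / 2 + (M - 1) / (L : ℝ) ^ 2)) := by
            refine div_le_div_of_nonneg_right ?_ h1m.le
            exact mul_le_mul hρM1.le hSMk hS0 zero_le_one
        _ ≤ 1 * Smax / (1 - ρ') := by
            rw [one_mul]
            exact div_le_div_of_nonneg_left hSmax h1ρ' (by linarith)
        _ = Smax / (1 - ρ') := by rw [one_mul]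
    linarith
  have hmain := sum_mul_insertionResponse_le aM aN x U ((L : ℝ) ^ 2 / 2 + (M - 1)) C₁ c α B hC₁ hc hPM0
    (kernelFT_insertionResponse_zero Δ M aM aN haN haM hρN hρM1 hPM0 x) hresp hU hIR
  linarith

end Finite

/-! ## The reduction on the density window, and the composed chain -/

/-- `(L : ℝ)⁻² → 0`. [folklore] -/
theorem tendsto_inv_sq_natCast : Tendsto (fun L : ℕ => ((L : ℝ) ^ 2)⁻¹) atTop (𝓝 0) :=
  ((tendsto_pow_atTop two_ne_zero).comp tendsto_natCast_atTop_atTop).inv_tendsto_atTop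

/-- The density of the reference sector `M − 1` has the same limit. [folklore] -/
theorem tendsto_density_pred (M : ℕ → ℝ) (ρ : ℝ)
    (hlim : Tendsto (fun L : ℕ => 1 / 2 + M L / (L : ℝ) ^ 2) atTop (𝓝 ρ)) :
    Tendsto (fun L : ℕ => 1 / 2 + (M L - 1) / (L : ℝ) ^ 2) atTop (𝓝 ρ) := by
  have h := hlim.sub tendsto_inv_sq_natCast
  rw [sub_zero] at h
  refine h.congr fun L => ?_
  rw [sub_div, one_div ((L : ℝ) ^ 2)]
  ring

/-- **THE REDUCTION `H1 ∧ (IR_α) ∧ (S ≤ S_max) ⇒ E_J` ON THE DENSITY WINDOW** (theory seat memo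
ROTOR-THEORY-7 §93; the content of the typed `EntropyRouteReduction`, there marked «Lean proof deferred»):
along every sector sequence with density `1/2 + M_L/L² → ρ ∈ (0,1)`, the one-body insertion structure H1,
the infrared structure bound (IR_α) and the upper structure bound give a uniform bound on the Jeffreys
divergence of insertion, `InsertionJBound Δ M`. [folklore] -/
theorem insertionJBound_of_onebody_infrared (Δ : ℝ) (M : ℕ → ℝ) (ρ : ℝ) (hρ : ρ ∈ Set.Ioo (0 : ℝ) 1)
    (hlim : Tendsto (fun L : ℕ => 1 / 2 + M L / (L : ℝ) ^ 2) atTop (𝓝 ρ))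
    (h1 : OneBodyInsertionStructure Δ M) (hIR : InfraredStructureBound Δ M)
    (hS : StructureFactorUpper Δ M) : InsertionJBound Δ M := by
  obtain ⟨r, C₁, h1⟩ := h1
  obtain ⟨c, hc, α, hα, hIR⟩ := hIR
  obtain ⟨Smax, hS⟩ := hS
  obtain ⟨Clat, hClat0, hClat⟩ := exists_sum_rpow_neg_torusNorm_le hα
  have hρ0 : 0 < ρ := hρ.1
  have hρ1 : ρ < 1 := hρ.2
  -- the density window, eventually
  have hlimM := tendsto_density_pred M ρ hlim
  have hN : ∀ᶠ L : ℕ in atTop, ρ / 2 ≤ 1 / 2 + M L / (L : ℝ) ^ 2 :=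
    hlim.eventually (eventually_ge_nhds (by linarith))
  have hMlo : ∀ᶠ L : ℕ in atTop, ρ / 2 ≤ 1 / 2 + (M L - 1) / (L : ℝ) ^ 2 :=
    hlimM.eventually (eventually_ge_nhds (by linarith))
  have hMhi : ∀ᶠ L : ℕ in atTop, 1 / 2 + (M L - 1) / (L : ℝ) ^ 2 ≤ (1 + ρ) / 2 :=
    hlimM.eventually (eventually_le_nhds (by linarith))
  -- the constant
  set C₁' : ℝ := max C₁ 0 with hC₁'
  set Smax' : ℝ := max Smax 0 with hSmax'
  set B : ℝ := Smax' + 1 + Smax' / (1 - (1 + ρ) / 2) with hB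
  have h1ρ : 0 < 1 - (1 + ρ) / 2 := by linarith
  have hB0 : 0 ≤ B := by rw [hB]; positivity
  refine ⟨r + C₁' * B / (c * (ρ / 2)) * Clat, ?_⟩
  filter_upwards [h1, hIR, hS, hN, hMlo, hMhi] with L h1L hIRL hSL hNL hMloL hMhiL
  intro _ aN aM haN haM x
  obtain ⟨hac, U, cst, R, hF, hrem, hU⟩ := h1L aN aM haN haM x
  refine ⟨hac, ?_⟩
  have hL : (0 : ℝ) < (L : ℝ) ^ 2 := by
    have : (0 : ℝ) < (L : ℝ) := by exact_mod_cast Nat.pos_of_ne_zero (NeZero.ne L)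
    positivity
  have hL' : (L : ℝ) ≠ 0 := by exact_mod_cast (NeZero.ne L)
  have hρN : 0 < 1 / 2 + M L / (L : ℝ) ^ 2 := lt_of_lt_of_le (by linarith) hNL
  have hρM0 : 0 < 1 / 2 + (M L - 1) / (L : ℝ) ^ 2 := lt_of_lt_of_le (by linarith) hMloL
  have hPM : (L : ℝ) ^ 2 / 2 + (M L - 1) = (L : ℝ) ^ 2 * (1 / 2 + (M L - 1) / (L : ℝ) ^ 2) := by
    field_simp
  have hPM0 : 0 < (L : ℝ) ^ 2 / 2 + (M L - 1) := by rw [hPM]; positivity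
  -- upgrade the data to the non-negative constants
  have hU' : ∀ k : TorusSite 2 L, k ≠ 0 →
      ‖kernelFT L U k‖ * structureFactor L aM ((L : ℝ) ^ 2 / 2 + (M L - 1)) k
          * ((L : ℝ) ^ 2 / 2 + (M L - 1)) ≤ C₁' * (L : ℝ) ^ 2 := fun k hk =>
    (hU k hk).trans (mul_le_mul_of_nonneg_right (le_max_left _ _) hL.le)
  have hSN' : ∀ k : TorusSite 2 L, k ≠ 0 →
      structureFactor L aN ((L : ℝ) ^ 2 / 2 + M L) k ≤ Smax' := fun k hk =>
    (hSL aN (M L) (Set.mem_insert _ _) haN k hk).trans (le_max_left _ _)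
  have hSM' : ∀ k : TorusSite 2 L, k ≠ 0 →
      structureFactor L aM ((L : ℝ) ^ 2 / 2 + (M L - 1)) k ≤ Smax' := fun k hk =>
    (hSL aM (M L - 1) (Set.mem_insert_of_mem _ (Set.mem_singleton _)) haM k hk).trans (le_max_left _ _)
  have hJ := jDiv_le_of_onebody_data Δ (M L) aM aN haN haM hρN hρM0 ((1 + ρ) / 2) (by linarith) hMhiL
    x U cst R r C₁' c α Smax' (le_max_right _ _) hc (le_max_right _ _) hac hF hrem hU' (hIRL aM haM)
    hSN' hSM'
  -- the lattice sum and the density floor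
  have hlat := hClat L
  have hcoef : 0 ≤ C₁' * B / (c * ((L : ℝ) ^ 2 / 2 + (M L - 1))) := by positivity
  have hstep : C₁' * B / (c * ((L : ℝ) ^ 2 / 2 + (M L - 1)))
      * ∑ k ∈ Finset.univ.filter (fun k : TorusSite 2 L => k ≠ 0), (torusNorm L k) ^ (-α)
      ≤ C₁' * B / (c * (ρ / 2)) * Clat := by
    calc C₁' * B / (c * ((L : ℝ) ^ 2 / 2 + (M L - 1)))
          * ∑ k ∈ Finset.univ.filter (fun k : TorusSite 2 L => k ≠ 0), (torusNorm L k) ^ (-α)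
        ≤ C₁' * B / (c * ((L : ℝ) ^ 2 / 2 + (M L - 1))) * (Clat * (L : ℝ) ^ 2) :=
          mul_le_mul_of_nonneg_left hlat hcoef
      _ = C₁' * B / (c * (1 / 2 + (M L - 1) / (L : ℝ) ^ 2)) * Clat := by
          rw [hPM]
          field_simp
      _ ≤ C₁' * B / (c * (ρ / 2)) * Clat := by
          refine mul_le_mul_of_nonneg_right ?_ hClat0
          refine div_le_div_of_nonneg_left (by positivity) (by positivity) ?_
          exact mul_le_mul_of_nonneg_left hMloL hc.le
  linarith

/-- **The composed chain `H1 ∧ (IR_α) ∧ (S ≤ S_max) ⇒ E`** (crux `InsertionEntropyBound`), support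
statements discharged, along a density sequence `→ ρ ∈ (0,1)`. [folklore] -/
theorem insertionEntropyBound_of_onebody_infrared (Δ : ℝ) (M : ℕ → ℝ) (ρ : ℝ)
    (hρ : ρ ∈ Set.Ioo (0 : ℝ) 1)
    (hlim : Tendsto (fun L : ℕ => 1 / 2 + M L / (L : ℝ) ^ 2) atTop (𝓝 ρ))
    (h1 : OneBodyInsertionStructure Δ M) (hIR : InfraredStructureBound Δ M)
    (hS : StructureFactorUpper Δ M) : InsertionEntropyBound Δ M := by
  have hρ0 : 0 < ρ := hρ.1
  have hρ1 : ρ < 1 := hρ.2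
  have hlimM := tendsto_density_pred M ρ hlim
  have hpos : ∀ᶠ L : ℕ in atTop, 0 < 1 / 2 + M L / (L : ℝ) ^ 2 :=
    hlim.eventually (eventually_gt_nhds hρ0)
  have hle : ∀ᶠ L : ℕ in atTop, 1 / 2 + (M L - 1) / (L : ℝ) ^ 2 ≤ (1 + ρ) / 2 :=
    hlimM.eventually (eventually_le_nhds (by linarith))
  exact insertionEntropyBound_of_jBound' Δ M ((1 + ρ) / 2) (by linarith) hpos hle
    (insertionJBound_of_onebody_infrared Δ M ρ hρ hlim h1 hIR hS)

/-- **THE ENTROPY ROUTE, KERNEL-CHECKED END TO END: `H1 ∧ (IR_α) ∧ (S ≤ S_max) ⇒ BEC`.**  Along every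
sector sequence of density `1/2 + M_L/L² → ρ ∈ (0,1)` with eventually non-trivial reference sectors, the
one-body insertion structure (H1, OPEN), the infrared structure bound ((IR_α), ⟸ LEMMA M + Landau (Λ_α)
+ compressibility (K₂)) and the upper structure bound (no Bragg peak) imply a uniform positive floor on
the condensate density of every Perron sector ground state of the XXZ / hard-core boson torus — the
conclusion of H0 in the rotor class, classical-side form (`EventualCondensate`).  Theory seat
hubbard-h0-rotor-theory-1, memo ROTOR-THEORY-7 §82–§102 (architecture v2, §93/§100). [folklore] -/
theorem eventualCondensate_of_onebody_infrared (Δ : ℝ) (M : ℕ → ℝ) (ρ : ℝ)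
    (hρ : ρ ∈ Set.Ioo (0 : ℝ) 1)
    (hlim : Tendsto (fun L : ℕ => 1 / 2 + M L / (L : ℝ) ^ 2) atTop (𝓝 ρ))
    (hsect : ∀ᶠ L : ℕ in atTop, ∀ [NeZero L], spinZSector (Λ := TorusSite 2 L) 1 (M L - 1) ≠ ⊥)
    (h1 : OneBodyInsertionStructure Δ M) (hIR : InfraredStructureBound Δ M)
    (hS : StructureFactorUpper Δ M) : EventualCondensate Δ M :=
  eventualCondensate_of_insertionEntropyBound' Δ M ρ hρ hlim hsect
    (insertionEntropyBound_of_onebody_infrared Δ M ρ hρ hlim h1 hIR hS)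

end Summit.HubbardSuperconductivity.HubbardSuperconductivity.Theorems.AnisotropyChord.InsertionEntropy
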